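import Summits.RiemannHypothesis.RiemannHypothesis.Theorems.OddSectorWindowLipschitzComparisonPhase
import HarnessLib

/-!
# Odd-sector window-Lipschitz, PART 3b: the weak maximum principle — pointwise edge law
# `‖u(x)‖² log(1/(a − |x|)) ≤ K(b₀, A)` for odd-sector ground states
# (pub-rhpf, transport-1, leaf G1.22 'TRANSPORT'; RH-free; def-free)

**mechanism/rigidity campaign; no RH claims.**  Companion text:
`run/shared/lean/pub/pub-rhpf/pub-rhpf-transport-1/TRANSPORT.md` §23 (odd-sector window-Lipschitz).

Odd-sector twin of `WeilWindowFlowWindowLipschitz.stub_comparison_phase` / `stub_comparison` (route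
WeilWindowFlow, line `borderline-barrier`, stub S3): if the explicit two-scale barrier
`B(x) = (log(1/min(a − |x|, d₀)))^{-1/2}` lies in the form domain (hypothesis S2a, discharged downstream by
the landed `stub_barrierEnergy`) and is a weak supersolution on the edge layer with surplus `c √(log 1/d₀)`
(hypothesis, discharged downstream by the landed `windowLipschitz_weakSurplus (windowLipschitz_surplus
stub_surplusReduction stub_surplusCalculus) stub_barrierWeakForm` — all `u`-independent), then ODD-SECTOR
ground states obey the pointwise edge law `‖u(x)‖² · log(1/(a − |x|)) ≤ K(b₀, A)` a.e. on the layer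
`a − d₀ < |x| < a`, uniformly for windows `a ∈ [b₀, A]` (`oddComparison`).

Proof: VERBATIM the even files, with the landed odd-sector spine in place of the even one — (C2)
`oddGroundState_finiteEnergy'`, (EL, all directions) `oddGroundState_eulerLagrange_all` (PART 1), (A)
`oddSupBound` (PART 2) — `IsWeilGroundState ↦ IsWeilOddGroundState`, `ε ↦ ε_od`,
`weilOddGroundEnergy_antitone`; the `u`-independent toolkit (`…StubComparisonAux`, `…StubSupBoundAux`) is
imported.  The test directions `(Re ζu − K₁B)⁺` are NOT odd (PART 1 is what makes the test legitimate).

Labels: PROVED tree material only (RH-free); no hypothesis is an open item.  Nothing here is a step toward RH.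

References: H. Chen, T. Weth, CPDE 44 (2019), arXiv:1710.03416, §§3–4; V. Hernández-Santamaría,
L. F. López Ríos, A. Saldaña, arXiv:2401.18033, Thm 1.1 / 2.4; P. A. Feulefack, S. Jarohs, T. Weth,
arXiv:2010.10448, §3; E. Bombieri, Rend. Mat. Acc. Lincei (9) 11 (2000), §4.
-/

set_option linter.dupNamespace false  -- D-0017 nested layout: `RiemannHypothesis.RiemannHypothesis`

noncomputable section

open MeasureTheory Set Filter
open scoped Topology ENNReal NNReal ComplexConjugate

namespace Summit.RiemannHypothesis.RiemannHypothesis.Theorems.OddSectorWindowLipschitz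

open Literature.NumberTheory.LFunctions
open Summit.RiemannHypothesis.RiemannHypothesis.Theorems.WeilWindowFlowWindowLipschitz

/-! ## The edge law -/

/-- **The pointwise edge law for odd-sector ground states, exponent `1/2`** (odd twin of
`WeilWindowFlowWindowLipschitz.stub_comparison`, same hypotheses S2a / weak surplus, same constants with
`ε ↦ ε_od`): from the barrier's form-domain membership (S2a) and its weak surplus
`c√(log 1/d₀)·∫w ≤ 𝓔_arch(B, w)` for all small `d₀`, together with the LANDED finite energy (C2,
`oddGroundState_finiteEnergy'`), all-direction Euler–Lagrange identity (EL, `oddGroundState_eulerLagrange_all`)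
and uniform sup bound (A, `oddSupBound`) of odd-sector ground states: on `[b₀, A]` there are `K, d₀` with
`‖u(x)‖² log(1/(a−|x|)) ≤ K` for a.e. `x` in the layer `a − d₀ < |x| < a`, for every odd-sector ground
state `u` of every window `a ∈ [b₀, A]` (four phases `ζ = ±1, ±i` of `oddComparison_phase`).
[cite: ChenWeth2017, §§3–4] -/
theorem oddComparison :
    (∀ (a d₀ : ℝ) (B : ℝ → ℝ), 0 < d₀ → 2 * d₀ ≤ 1 → d₀ < a →
      (∀ x, B x = if |x| < a then 1 / Real.sqrt (Real.log (1 / min (a - |x|) d₀)) else 0) →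
      Measurable B ∧ (∀ x, 0 ≤ B x ∧ B x ≤ 1 / Real.sqrt (Real.log (1 / d₀))) ∧
        (∀ x, a ≤ |x| → B x = 0) ∧ MemLp (fun x ↦ (B x : ℂ)) 2 ∧
        IntegrableOn (fun t ↦ weilArchDensity t * weilIncrement (fun x ↦ (B x : ℂ)) t) (Ioi 0)) →
    (∃ c d₁ : ℝ, 0 < c ∧ 0 < d₁ ∧ 2 * d₁ ≤ 1 ∧ ∀ (a d₀ : ℝ) (B : ℝ → ℝ), 0 < d₀ → d₀ ≤ d₁ → d₀ < a →
      (∀ x, B x = if |x| < a then 1 / Real.sqrt (Real.log (1 / min (a - |x|) d₀)) else 0) →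
      ∀ w : ℝ → ℝ, MemLp w 2 → (∀ᵐ x : ℝ, 0 ≤ w x) →
        (∀ᵐ x : ℝ, ¬(a - d₀ < |x| ∧ |x| < a) → w x = 0) →
        c * Real.sqrt (Real.log (1 / d₀)) * ∫ x, w x ≤
          ∫ t in Ioi (0 : ℝ), weilArchDensity t * ∫ x, (B (x + t) - B x) * (w (x + t) - w x)) →
    ∀ b₀ A : ℝ, 0 < b₀ → b₀ ≤ A → ∃ K d₀ : ℝ, 0 < d₀ ∧ d₀ < 1 ∧
      ∀ (a : ℝ) (u : ℝ → ℂ), b₀ ≤ a → a ≤ A → IsWeilOddGroundState a u →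
        ∀ᵐ x : ℝ, a - d₀ < |x| → |x| < a → ‖u x‖ ^ 2 * Real.log (1 / (a - |x|)) ≤ K := by
  intro hBar hWk b₀ A hb₀ hbA
  obtain ⟨c, d₁, hc, hd₁, hd₁1, hweak⟩ := hWk
  have hC2 := oddGroundState_finiteEnergy'
  have hEL := oddGroundState_eulerLagrange_all
  obtain ⟨K₀, hK₀⟩ := oddSupBound hC2 hEL b₀ A hb₀ hbA
  -- constants
  set Csup : ℝ := max K₀ 1 with hCsupdef
  have hCsup1 : 1 ≤ Csup := le_max_right _ _
  set SA : ℝ := ∑ n ∈ weilPrimeIndex A, (ArithmeticFunction.vonMangoldt n : ℝ) / Real.sqrt n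
    with hSAdef
  set CF : ℝ := |weilMarkovConstant b₀| + |weilMarkovConstant A| + |weilOddGroundEnergy b₀| +
    |weilOddGroundEnergy A| + 4 * Real.exp A ^ 2 * (A + 1 / 2) + 2 * SA with hCFdef
  set d₀ : ℝ := min d₁ (min (b₀ / 2) (Real.exp (-((CF + 1) / c)))) with hd₀def
  have hd₀pos : 0 < d₀ := lt_min hd₁ (lt_min (by linarith) (Real.exp_pos _))
  have hd₀d₁ : d₀ ≤ d₁ := min_le_left _ _
  have hd₀b : d₀ ≤ b₀ / 2 := (min_le_right _ _).trans (min_le_left _ _)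
  have hd₀e : d₀ ≤ Real.exp (-((CF + 1) / c)) := (min_le_right _ _).trans (min_le_right _ _)
  have hd₀1 : d₀ < 1 := by linarith
  have h2d₀ : 2 * d₀ ≤ 1 := by linarith
  have hL₀ : CF + 1 ≤ c * Real.log (1 / d₀) := by
    have h1 : (CF + 1) / c ≤ Real.log (1 / d₀) := by
      rw [one_div, Real.log_inv, le_neg, ← Real.log_exp (-((CF + 1) / c))]
      exact Real.log_le_log hd₀pos hd₀e
    rwa [div_le_iff₀' hc] at h1
  refine ⟨4 * Csup ^ 2 * Real.log (1 / d₀), d₀, hd₀pos, hd₀1, fun a u hba haA hu ↦ ?_⟩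
  have hd₀a : d₀ < a := by linarith
  -- the barrier of this window
  set B : ℝ → ℝ := fun x ↦ if |x| < a then 1 / Real.sqrt (Real.log (1 / min (a - |x|) d₀)) else 0
    with hBdef
  have hB : ∀ x, B x = if |x| < a then 1 / Real.sqrt (Real.log (1 / min (a - |x|) d₀)) else 0 :=
    fun x ↦ rfl
  obtain ⟨hBm, hBb, hB0, hB2, hBE⟩ := hBar a d₀ B hd₀pos h2d₀ hd₀a hB
  have hBp : ∀ x, |x| ≤ a - d₀ → B x = 1 / Real.sqrt (Real.log (1 / d₀)) := by
    intro x hx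
    rw [hB, if_pos (by linarith), min_eq_right (by linarith)]
  have hweak' := hweak a d₀ B hd₀pos hd₀d₁ hd₀a hB
  -- normalise `u` to vanish off the window
  set u' : ℝ → ℂ := (Icc (-a) a).indicator u with hu'
  have hgs : IsWeilOddGroundState a u' := hu.congr_ae hu.ae_eq_indicator
  have hu'0 : ∀ x, x ∉ Icc (-a) a → u' x = 0 := fun x hx ↦ indicator_of_notMem hx _
  -- the constant `C_F` dominates the window-`a` constants
  have hSa : ∑ n ∈ weilPrimeIndex a, (ArithmeticFunction.vonMangoldt n : ℝ) / Real.sqrt n ≤ SA :=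
    Finset.sum_le_sum_of_subset_of_nonneg (stub_supBound_weilPrimeIndex_mono haA)
      (fun n _ _ ↦ div_nonneg ArithmeticFunction.vonMangoldt_nonneg (Real.sqrt_nonneg _))
  have hMa : |weilMarkovConstant a| ≤ |weilMarkovConstant b₀| + |weilMarkovConstant A| := by
    have h1 := stub_supBound_weilMarkovConstant_mono hba
    have h2 := stub_supBound_weilMarkovConstant_mono haA
    rw [abs_le]
    constructor <;>
      linarith [neg_abs_le (weilMarkovConstant b₀), le_abs_self (weilMarkovConstant A),
        abs_nonneg (weilMarkovConstant b₀), abs_nonneg (weilMarkovConstant A)]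
  have hεa : |weilOddGroundEnergy a| ≤ |weilOddGroundEnergy b₀| + |weilOddGroundEnergy A| := by
    have h1 := weilOddGroundEnergy_antitone hb₀ hba
    have h2 := weilOddGroundEnergy_antitone (hb₀.trans_le hba) haA
    rw [abs_le]
    constructor <;>
      linarith [neg_abs_le (weilOddGroundEnergy A), le_abs_self (weilOddGroundEnergy b₀),
        abs_nonneg (weilOddGroundEnergy b₀), abs_nonneg (weilOddGroundEnergy A)]
  have hCFa : |weilMarkovConstant a| + |weilOddGroundEnergy a| + 4 * Real.exp A ^ 2 * (A + 1 / 2) +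
      2 * (∑ n ∈ weilPrimeIndex a, (ArithmeticFunction.vonMangoldt n : ℝ) / Real.sqrt n) ≤ CF := by
    rw [hCFdef]
    linarith
  -- one phase at a time
  have key : ∀ ζ : ℂ, ‖ζ‖ = 1 →
      ∀ᵐ x : ℝ, (ζ * u' x).re ≤ Csup * Real.sqrt (Real.log (1 / d₀)) * B x := by
    intro ζ hζ
    have hgsζ : IsWeilOddGroundState a (fun x ↦ ζ * u' x) := hgs.const_mul hζ
    have hbd : ∀ᵐ x : ℝ, ‖ζ * u' x‖ ≤ Csup := by
      filter_upwards [hK₀ a _ hba haA hgsζ] with x hx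
      exact hx.trans (le_max_left _ _)
    exact oddComparison_phase haA hd₀pos hd₀1 hgsζ (fun x hx ↦ by rw [hu'0 x hx, mul_zero])
      hCsup1 hbd hBm hBb hB0 hBp hB2 hBE hweak' hCFa hL₀
  have h1 := key 1 (by simp)
  have h2 := key (-1) (by simp)
  have h3 := key Complex.I (by simp)
  have h4 := key (-Complex.I) (by simp)
  filter_upwards [h1, h2, h3, h4, hu.ae_eq_indicator] with x h1 h2 h3 h4 hx hxl hxa
  rw [hx]
  simp only [one_mul, neg_mul, Complex.neg_re, Complex.mul_re, Complex.I_re, Complex.I_im,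
    zero_mul, one_mul, zero_sub] at h1 h2 h3 h4
  set K₁ : ℝ := Csup * Real.sqrt (Real.log (1 / d₀)) with hK₁def
  have hnorm : ‖u' x‖ ≤ 2 * (K₁ * B x) := by
    calc ‖u' x‖ ≤ |(u' x).re| + |(u' x).im| := Complex.norm_le_abs_re_add_abs_im _
      _ ≤ K₁ * B x + K₁ * B x :=
          add_le_add (abs_le.2 ⟨by linarith, h1⟩) (abs_le.2 ⟨by linarith, by linarith⟩)
      _ = 2 * (K₁ * B x) := by ring
  -- on the layer `B x = (log(1/(a - |x|)))^{-1/2}`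
  have hdpos : 0 < a - |x| := sub_pos.2 hxa
  have hdlt : a - |x| < d₀ := by linarith
  set ℓ : ℝ := Real.log (1 / (a - |x|)) with hℓdef
  have hℓpos : 0 < ℓ := Real.log_pos (by rw [lt_div_iff₀ hdpos]; nlinarith)
  have hBx : B x = 1 / Real.sqrt ℓ := by
    rw [hB, if_pos hxa, min_eq_left hdlt.le]
  have hsℓ : 0 < Real.sqrt ℓ := Real.sqrt_pos.2 hℓpos
  have hL₀nn : 0 ≤ Real.log (1 / d₀) := (Real.log_pos (by rw [lt_div_iff₀ hd₀pos]; linarith)).le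
  have hsq : ‖u' x‖ ^ 2 ≤ (2 * (K₁ * B x)) ^ 2 := pow_le_pow_left₀ (norm_nonneg _) hnorm 2
  have hK₁sq : K₁ ^ 2 = Csup ^ 2 * Real.log (1 / d₀) := by
    rw [hK₁def, mul_pow, Real.sq_sqrt hL₀nn]
  have hBsq : B x ^ 2 * ℓ = 1 := by
    rw [hBx, div_pow, one_pow, Real.sq_sqrt hℓpos.le]
    field_simp
  calc ‖u' x‖ ^ 2 * ℓ ≤ (2 * (K₁ * B x)) ^ 2 * ℓ := mul_le_mul_of_nonneg_right hsq hℓpos.le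
    _ = 4 * K₁ ^ 2 * (B x ^ 2 * ℓ) := by ring
    _ = 4 * Csup ^ 2 * Real.log (1 / d₀) := by rw [hBsq, hK₁sq, mul_one]; ring

end Summit.RiemannHypothesis.RiemannHypothesis.Theorems.OddSectorWindowLipschitz

end
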